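import Literature.Geometry.DiscreteGeometry.KissingPatterns
import Literature.Geometry.DiscreteGeometry.KissingRigidity
import Summits.AtomisticToContinuum.Crystallization.Theses.TwoCentreKissingKernel
import HarnessLib

/-!
# `RobustTangencyBound` — from a labelled approximation to `ShellCloseTo` (helper file)

Helper lemmas for item `stmt-AtomisticToContinuum-12082` (`RobustTangencyBound`, route
`TwoCentreKissingKernel`, sub-problem Crystallization): the final glue of the programme recorded in
the item's notes.  Steps (III)–(V) there produce an ENUMERATION `x : Fin 12 → ℝ³` of the shell, a
linear isometry `A`, and pointwise bounds `dist (x i) (A (p i)) ≤ δ` against an enumeration `p` of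
the pattern; this file turns that into the tree predicate
`ShellCloseTo δ T P = ∃ A, EtaMatched δ T (P.image A)` (a bijection `T ≃ A(P)` moving points by
`≤ δ`), for any injectively enumerated `T` and `P` (`shellCloseTo_of_labelled`), and records the
enumerations of the two patterns by the tables `fccTab`, `hcpTab` of `KissingRigidity.lean`
(`fccPt`, `hcpPt`: `fccKissingPattern = univ.image fccPt`, injective), giving
`shellCloseTo_fcc_of_labelled`, `shellCloseTo_hcp_of_labelled`.
-/

noncomputable section

namespace Summit.AtomisticToContinuum.Crystallization.Theorems

open Literature.Geometry.DiscreteGeometry Finset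

/-- **Labelled approximation gives `ShellCloseTo`.** If `x, p : Fin 12 → ℝ³` injectively
enumerate the finite sets `T` and `P`, `A` is a linear isometry and `dist (x i) (A (p i)) ≤ δ` for
all `i`, then `ShellCloseTo δ T P`: the matching is `x i ↦ A (p i)`. -/
theorem shellCloseTo_of_labelled {δ : ℝ} {T P : Finset (EuclideanSpace ℝ (Fin 3))}
    (x p : Fin 12 → EuclideanSpace ℝ (Fin 3)) (hx : Function.Injective x)
    (hp : Function.Injective p) (hT : T = Finset.univ.image x) (hP : P = Finset.univ.image p)
    (A : EuclideanSpace ℝ (Fin 3) →ₗᵢ[ℝ] EuclideanSpace ℝ (Fin 3))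
    (h : ∀ i, dist (x i) (A (p i)) ≤ δ) : ShellCloseTo δ T P := by
  classical
  refine ⟨A, ?_⟩
  -- index of a point of `T`
  have hex : ∀ t : ↥T, ∃ i, x i = t := fun t => by
    have ht : (t : EuclideanSpace ℝ (Fin 3)) ∈ Finset.univ.image x := hT ▸ t.2
    obtain ⟨i, -, hi⟩ := Finset.mem_image.1 ht
    exact ⟨i, hi⟩
  choose idx hidx using hex
  have hApmem : ∀ i, A (p i) ∈ P.image A := fun i => by
    rw [hP, Finset.image_image]
    exact Finset.mem_image_of_mem _ (Finset.mem_univ _)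
  let f : ↥T → ↥(P.image A) := fun t => ⟨A (p (idx t)), hApmem (idx t)⟩
  have hfinj : Function.Injective f := by
    intro t t' htt
    have h1 : A (p (idx t)) = A (p (idx t')) := congrArg Subtype.val htt
    have h2 : idx t = idx t' := hp (A.injective h1)
    apply Subtype.ext
    rw [← hidx t, ← hidx t', h2]
  have hcard : Fintype.card ↥T = Fintype.card ↥(P.image A) := by
    rw [Fintype.card_coe, Fintype.card_coe, hT, hP, Finset.image_image,
      Finset.card_image_of_injective _ hx,
      Finset.card_image_of_injective _ (A.injective.comp hp)]
  have hfbij : Function.Bijective f := (Fintype.bijective_iff_injective_and_card f).2 ⟨hfinj, hcard⟩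
  refine ⟨Equiv.ofBijective f hfbij, fun t => ?_⟩
  show dist (t : EuclideanSpace ℝ (Fin 3)) (A (p (idx t))) ≤ δ
  rw [← hidx t]
  exact h (idx t)

/-- The FCC pattern point with index `i`: `fccTab i / √2` (a unit vector; the tables are those
of `KissingRigidity.lean`, so `fccPt i = ½ · fccRef i`). -/
theorem fccKissingPattern_eq_image :
    fccKissingPattern =
      Finset.univ.image fun i : Fin 12 => (Real.sqrt 2)⁻¹ • intVec (fccTab i) := by
  rw [fccKissingPattern, scaledPattern, fccInt_eq_image, Finset.image_image]
  rfl

/-- The HCP pattern enumerated by `hcpTab`: `hcpKissingPattern = {hcpTab i / √18}`. -/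
theorem hcpKissingPattern_eq_image :
    hcpKissingPattern =
      Finset.univ.image fun i : Fin 12 => (Real.sqrt 18)⁻¹ • intVec (hcpTab i) := by
  rw [hcpKissingPattern, scaledPattern, hcpInt_eq_image, Finset.image_image]
  rfl

/-- The FCC enumeration is injective. -/
theorem fccPt_injective :
    Function.Injective fun i : Fin 12 =>
      ((Real.sqrt 2)⁻¹ • intVec (fccTab i) : EuclideanSpace ℝ (Fin 3)) :=
  (scaledPattern_map_injective two_ne_zero).comp fccTab_injective

/-- The HCP enumeration is injective. -/
theorem hcpPt_injective :
    Function.Injective fun i : Fin 12 =>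
      ((Real.sqrt 18)⁻¹ • intVec (hcpTab i) : EuclideanSpace ℝ (Fin 3)) :=
  (scaledPattern_map_injective (by norm_num)).comp hcpTab_injective

/-- **Labelled `δ`-approximation of the FCC pattern gives `ShellCloseTo δ T fccKissingPattern`.**
If `x : Fin 12 → ℝ³` injectively enumerates `T` and some linear isometry `A` has
`dist (x i) (A (fccTab i/√2)) ≤ δ` for every `i`, the shell is `δ`-close to the FCC pattern. -/
theorem shellCloseTo_fcc_of_labelled {δ : ℝ} {T : Finset (EuclideanSpace ℝ (Fin 3))}
    (x : Fin 12 → EuclideanSpace ℝ (Fin 3)) (hx : Function.Injective x)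
    (hT : T = Finset.univ.image x) (A : EuclideanSpace ℝ (Fin 3) →ₗᵢ[ℝ] EuclideanSpace ℝ (Fin 3))
    (h : ∀ i, dist (x i) (A ((Real.sqrt 2)⁻¹ • intVec (fccTab i))) ≤ δ) :
    ShellCloseTo δ T fccKissingPattern :=
  shellCloseTo_of_labelled x _ hx fccPt_injective hT fccKissingPattern_eq_image A h

/-- **Labelled `δ`-approximation of the HCP pattern gives `ShellCloseTo δ T hcpKissingPattern`.** -/
theorem shellCloseTo_hcp_of_labelled {δ : ℝ} {T : Finset (EuclideanSpace ℝ (Fin 3))}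
    (x : Fin 12 → EuclideanSpace ℝ (Fin 3)) (hx : Function.Injective x)
    (hT : T = Finset.univ.image x) (A : EuclideanSpace ℝ (Fin 3) →ₗᵢ[ℝ] EuclideanSpace ℝ (Fin 3))
    (h : ∀ i, dist (x i) (A ((Real.sqrt 18)⁻¹ • intVec (hcpTab i))) ≤ δ) :
    ShellCloseTo δ T hcpKissingPattern :=
  shellCloseTo_of_labelled x _ hx hcpPt_injective hT hcpKissingPattern_eq_image A h

/-- **Enumerating a twelve-point shell.** A `Finset` of twelve points is injectively enumerated
by `Fin 12` (via `Finset.equivFin`); packaged in the form the labelled lemmas consume. -/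
theorem exists_enumeration_of_card_eq_twelve {T : Finset (EuclideanSpace ℝ (Fin 3))}
    (hT : T.card = 12) :
    ∃ x : Fin 12 → EuclideanSpace ℝ (Fin 3), Function.Injective x ∧ T = Finset.univ.image x := by
  classical
  let e : ↥T ≃ Fin 12 := T.equivFinOfCardEq hT
  refine ⟨fun i => ((e.symm i : ↥T) : EuclideanSpace ℝ (Fin 3)),
    Subtype.val_injective.comp e.symm.injective, ?_⟩
  ext y
  constructor
  · intro hy
    exact Finset.mem_image.2 ⟨e ⟨y, hy⟩, Finset.mem_univ _, by simp⟩
  · intro hy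
    obtain ⟨i, -, rfl⟩ := Finset.mem_image.1 hy
    exact (e.symm i).2

end Summit.AtomisticToContinuum.Crystallization.Theorems

end
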